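import Summits.NavierStokesRegularity.NavierStokesRegularity.Theses.QuantisedSymmetry
import Summits.NavierStokesRegularity.NavierStokesRegularity.Theses.Blowup
import Summits.NavierStokesRegularity.NavierStokesRegularity.Theorems.QuantisedSymmetryPolyhedralTruncationBridge
import Summits.NavierStokesRegularity.NavierStokesRegularity.Theorems.QuantisedSymmetryPolyhedralDssProfileExistsDominatesBlowupProfile
import Literature.Analysis.FluidPDE.SelfSimilar
import Literature.Analysis.FluidPDE.SelfSimilarLiouville

/-!
# Strategist companion `s21-g3` for crux `PolyhedralDssProfileExists` (X⁻, stmt-NavierStokesRegularity-1404)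

Typed content of `STRATEGY-CENSUS-s21.md` (family `-s`, gen 3, independent census). Sorry-free.

* §0 `crux_decides_summit` — the crux ALONE refutes the summit on tree theorems
  (`closes` ∘ `quantisedSymmetry_polyhedralTruncationBridge_proof` ∘ `ClayUniqueness_holds`).
* §1 `TypeIDssProfileExists` — the symmetry-free core X₀ of the crux; `core_of_crux : X → X₀` and
  `core_decides_summit : X₀ → ¬ NavierStokesRegularity` (the `G`-clauses are decoration on the summit
  path: the proved bridge ignores them). Hence the split `X ⇐ X₀ ∧ (X₀ → X)` has a summit-deciding piece.
* §2 `blowupTypeIDssProfile_decides_summit` — the weakest intermediate on the ladder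
  `X ⇒ X₀ ⇒ W₁ := Blowup.BlowupTypeIDssProfile` (stmt-0155; `X ⇒ W₁` is the landed
  `stub_dominatesBlowupProfile`) still refutes the summit on tree theorems
  (`filamentSkeletonRss_rdssProfileTruncation_proof` + `ClayUniqueness_holds` + the `closes` glue):
  no closing replacement of the crux is short of the summit.
* §3 the typed shapes of the two honest decompositions considered (certificate split, compactness split),
  with their trivially proved assemblies, recorded as `Prop`-schemas so the census can point at them.
-/

namespace Summit.NavierStokesRegularity.NavierStokesRegularity.Cruxes.PolyhedralDssProfileExists.S21g3

open MeasureTheory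
open Literature.Analysis.FluidPDE
open Summit.NavierStokesRegularity.NavierStokesRegularity.Theses

noncomputable section

/-- The crux, by name. -/
abbrev X : Prop := QuantisedSymmetry.PolyhedralDssProfileExists

/-! ## §0 The crux alone decides the summit -/

/-- `X⁻ ⊢ ¬ NavierStokesRegularity` on tree theorems: the other two binders of `closes` are proved. -/
theorem crux_decides_summit (hX : X) : ¬ _root_.NavierStokesRegularity :=
  QuantisedSymmetry.closes hX
    _root_.Summit.NavierStokesRegularity.NavierStokesRegularity.Theorems.quantisedSymmetry_polyhedralTruncationBridge_proof
    QuantisedSymmetry.ClayUniqueness_holds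

/-- The finite-lifespan conclusion `X5a` refutes the summit, given the PROVED Clay uniqueness
(`ClayUniqueness_holds`); the argument is the body of the route's `closes` (Beale–Kato–Majda maximal
interval), copied so that this file depends on built modules only. -/
theorem not_regularity_of_X5a
    (hX5a : ∃ ν : ℝ, 0 < ν ∧ ∃ T : ℝ, 0 < T ∧
      ∃ (u : ℝ → EuclideanSpace ℝ (Fin 3) → EuclideanSpace ℝ (Fin 3)) (p : ℝ → EuclideanSpace ℝ (Fin 3) → ℝ),
        IsMaximalSmoothSolution ν 0 u p T ∧ IsLerayHopfOn T ν 0 (u 0) u ∧ HasRapidSpatialDecay (u 0)) :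
    ¬ _root_.NavierStokesRegularity := by
  rintro hA
  have hU := QuantisedSymmetry.ClayUniqueness_holds
  obtain ⟨ν, hν, T, hT, u, p, ⟨hcl, hmax⟩, hLH, hdecay⟩ := hX5a
  have h0 : (0 : ℝ) ∈ Set.Ico 0 T := ⟨le_rfl, hT⟩
  obtain ⟨u', p', hu', hp', hns, hbe⟩ :=
    hA ν hν (u 0) (hcl.contDiff_velocity h0) (hcl.divFree 0 h0) hdecay
  have heq : ∀ t ∈ Set.Ico 0 T, u' t = u t :=
    hU ν hν (u 0) hdecay u' u p' p T hT hu' hp' hns hbe hcl hLH rfl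
  have hcl' : IsClassicalNSSolutionOn (Set.Ici 0) ν 0 u' p' :=
    ⟨hu', hp', fun t ht x => hns.momentum t ht x, fun t ht => hns.divFree t ht⟩
  refine hmax ⟨T + 1, by linarith, u', p', ?_, heq⟩
  exact hcl'.mono (fun t ht => ht.1) (uniqueDiffOn_Ico 0 (T + 1))

/-! ## §1 The symmetry-free core and the `core ∧ symmetrise` split -/

/-- X₀: a nontrivial Type-I `c`-DSS ancient mild profile (duality form, measurable slices) — the crux with
its three `G`-clauses deleted. -/
def TypeIDssProfileExists : Prop :=
  ∃ c : ℝ, 1 < c ∧ ∃ u : ℝ → EuclideanSpace ℝ (Fin 3) → EuclideanSpace ℝ (Fin 3),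
    IsAncientMildSolution 1 u ∧ (∀ t < 0, AEStronglyMeasurable (u t) volume) ∧
    IsDiscretelySelfSimilar c u ∧ (∃ C₀ : ℝ, HasTypeIDecay C₀ u) ∧ ¬ (∀ t < 0, u t =ᵐ[volume] 0)

/-- `X → X₀` (forget the group). -/
theorem core_of_crux (hX : X) : TypeIDssProfileExists := by
  obtain ⟨G, -, -, -, c, hc, u, hanc, hmeas, hdss, hdec, -, hnt⟩ := hX
  exact ⟨c, hc, u, hanc, hmeas, hdss, hdec, hnt⟩

/-- `X₀` alone refutes the summit: the symmetry-free rotated truncation bridge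
`filamentSkeletonRss_rdssProfileTruncation_proof` (at the trivial rotation) gives `X5a`, and
`ClayUniqueness_holds` + the maximal-interval glue (`not_regularity_of_X5a`) finish. -/
theorem core_decides_summit (h : TypeIDssProfileExists) : ¬ _root_.NavierStokesRegularity := by
  obtain ⟨c, hc, u, hanc, hmeas, hdss, hdec, hnt⟩ := h
  exact not_regularity_of_X5a
    (_root_.Summit.NavierStokesRegularity.NavierStokesRegularity.Theorems.filamentSkeletonRss_rdssProfileTruncation_proof
      ⟨c, LinearIsometryEquiv.refl ℝ (EuclideanSpace ℝ (Fin 3)), u, hc, hanc, hmeas,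
        isRotatedDSS_refl_iff.mpr hdss, hdec, hnt⟩)

/-- Split A, second piece: symmetrisation ("some Type-I DSS profile class contains a polyhedrally
equivariant one"). -/
def Symmetrise : Prop := TypeIDssProfileExists → X

/-- Split A assembles trivially — and is NOT a redirect: its first piece decides the summit
(`core_decides_summit`), violating "no piece gives S on its own". -/
theorem splitA_assembly (h₁ : TypeIDssProfileExists) (h₂ : Symmetrise) : X := h₂ h₁

/-! ## §2 The weakest closing intermediate is still summit-deciding -/

/-- `W₁ := Blowup.BlowupTypeIDssProfile` (stmt-0155: failure of the Type-I (rotated-)DSS Liouville wall)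
refutes the summit on tree theorems. Together with the landed `X → W₁`
(`PolyhedralCell.stub_dominatesBlowupProfile`) this shows: every statement between `X` and `W₁` that can
replace `hX` in `closes` decides the Millennium problem by itself. -/
theorem blowupTypeIDssProfile_decides_summit (hW : Blowup.BlowupTypeIDssProfile) :
    ¬ _root_.NavierStokesRegularity := by
  classical
  unfold Blowup.BlowupTypeIDssProfile at hW
  push_neg at hW
  obtain ⟨c, hc⟩ := hW
  refine not_regularity_of_X5a
    (_root_.Summit.NavierStokesRegularity.NavierStokesRegularity.Theorems.filamentSkeletonRss_rdssProfileTruncation_proof ?_)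
  by_cases hL : TypeIDSSLiouville c
  · obtain ⟨R, hR⟩ := hc hL
    unfold RotatedTypeIDSSLiouville at hR
    push_neg at hR
    obtain ⟨hc1, u, hanc, hmeas, hrdss, hdec, hnt⟩ := hR
    exact ⟨c, R, u, hc1, hanc, hmeas, hrdss, hdec, fun h => by
      obtain ⟨t, ht, hne⟩ := hnt; exact hne (h t ht)⟩
  · unfold TypeIDSSLiouville at hL
    push_neg at hL
    obtain ⟨hc1, u, hanc, hmeas, hdss, hdec, hnt⟩ := hL
    exact ⟨c, LinearIsometryEquiv.refl ℝ (EuclideanSpace ℝ (Fin 3)), u, hc1, hanc, hmeas,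
      isRotatedDSS_refl_iff.mpr hdss, hdec, fun h => by
      obtain ⟨t, ht, hne⟩ := hnt; exact hne (h t ht)⟩

/-- The domination `X → W₁`, by name (landed p156644). -/
theorem crux_dominates_W₁ (hX : X) : Blowup.BlowupTypeIDssProfile :=
  _root_.Summit.NavierStokesRegularity.NavierStokesRegularity.Theorems.PolyhedralDssProfileExists.PolyhedralCell.stub_dominatesBlowupProfile
    hX

/-! ## §3 Shapes of the two honest decompositions (schemas)

Both are recorded as schemas over abstract `Prop`s because their open piece is, in each case, the crux
again (see the census): typing them concretely would only restate `X`. -/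

/-- Certificate (Newton–Kantorovich / computer-assisted) split: `Cert ∧ (Cert → X)`. The verification
half is plausible mathematics (radii-polynomial / NK on a weighted space); the certificate half needs a
numerical candidate, of which none exists in the Type-I class, and `Cert ⇒ X ∧ nondegeneracy`. -/
theorem certificate_split {Cert : Prop} (h₁ : Cert) (h₂ : Cert → X) : X := h₂ h₁

/-- Compactness split: (approximate episodes for every tolerance) ∧ (closure under limits) → X. The
closure half is Type-I weak-* stability of ancient mild solutions (KNSS 2009 / Seregin–Šverák 2009
type); the episode half is equivalent to `X` given the proved truncation bridge (an exact profile
truncates to arbitrarily long exact episodes), so the open piece is the crux. -/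
theorem compactness_split {Episodes Closure : Prop} (h₁ : Episodes) (h₂ : Closure)
    (glue : Episodes → Closure → X) : X := glue h₁ h₂

end

end Summit.NavierStokesRegularity.NavierStokesRegularity.Cruxes.PolyhedralDssProfileExists.S21g3
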